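import Summits.BirchSwinnertonDyer.BirchSwinnertonDyer.Theses.TwinTransportX9
import Summits.BirchSwinnertonDyer.Rank1Residual.X9.TwistStability
import Literature.NumberTheory.EllipticCurves.ModularParametrizationBCDTProofs
import HarnessLib

/-!
# Route `TwinTransportX9` — the ASSEMBLY item and the LINE-4 glue `ResidualTransportX9`, kernel-checked

Two glue items of route `route-BirchSwinnertonDyer-TwinTransportX9` (ideator seat bsd-idea-2, g2) are
PROVED here, sorry-free, from the route's own open items as hypotheses:

* `Summit.BirchSwinnertonDyer.BirchSwinnertonDyer.Theses.TwinTransportX9.Assembly` :=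
  `TwistDefectBalanceX9 → TrivialTwinSupplyX9 → TwinDefectZeroX9 → TamagawaResidualIMCX9 →
  PublishedInputsX9 → IntegralMainConjectureOnClassX9` (`twinTransportX9_assembly`);
* `Summit.BirchSwinnertonDyer.BirchSwinnertonDyer.Theses.TwinTransportX9.ResidualTransportX9` :=
  `TwistDefectBalanceX9 → TamagawaTwinSupplyX9 → RankZeroBSDpToIMCX9 → PublishedInputsX9 →
  TamagawaResidualIMCX9` (`twinTransportX9_residualTransport`).

THE TRANSPORT (both proofs): at an X9 pair `(E, p)` take the BCS datum `(g, k)` of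
`burungale_castella_skinner_charIdeal_eq_padicLFunction` (`char X = (g)`, `ι g = p^k · L_p(f, α)`);
it suffices to show `k = 0`.  The supply item gives a chain of at most two BCS-admissible
imaginary-quadratic twists `E ~ E₁ ~ E₂` ending at a twin; the twists stay in class X9
(`X9.classX9_of_smul_eq_quadraticTwist`: `d_K` is square-free and prime to `p` by admissibility), are
modular (`exists_isNewformOf_of_nonempty_modularParametrizationData`) and carry cyclotomic Selmer duals
(`WeierstrassCurve.nonempty_selmerDualData_holds`).  At the twin the zero-defect item supplies a
generator with `ι g' = L_p` EXACTLY, i.e. a BCS datum with exponent `0`; the balance item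
`TwistDefectBalanceX9` (`k + k' = 0` for ANY pair of BCS data along an admissible step) then forces the
exponent at the previous curve to vanish, and once more back to `E` (`defect_eq_zero_of_step`).  No unit
or non-vanishing argument is needed: the balance is applied to the exact generator with `k' = 0`.

Nothing is booked: the balance, the supplies, the zero-defect items and the residual are OPEN items of the
route and enter as hypotheses; no summit and no leaf is proved by this file — it certifies that the
route's cone is honest (the deciding theorem `closes` consumes exactly these items).

THEOREMS ONLY (no definition, no named fact, no `sorry`); cell-independent (ideator seat bsd-idea-2 g2).
-/

set_option linter.dupNamespace false
set_option autoImplicit false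

noncomputable section

open scoped Classical

open WeierstrassCurve Literature.NumberTheory.EllipticCurves Literature.NumberTheory.EllipticCurves.ModularForms
  Summit.BirchSwinnertonDyer.BirchSwinnertonDyer.Rank1Residual

open Summit.BirchSwinnertonDyer.BirchSwinnertonDyer.Theses.TwinTransportX9
  (TwistDefectBalanceX9 TrivialTwinSupplyX9 TwinDefectZeroX9 TamagawaResidualIMCX9 PublishedInputsX9
    TamagawaTwinSupplyX9 RankZeroBSDpToIMCX9 ResidualTransportX9 Assembly)

namespace Summit.BirchSwinnertonDyer.BirchSwinnertonDyer.Rank1Residual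

namespace TwinTransport

/-! ### §1 One transport step -/

/-- **One transport step.** Along a BCS-admissible step `W ~ W₁`, if SOME generator `g₁` of the
characteristic ideal of a cyclotomic Selmer dual of `W₁` satisfies `ι g₁ = L_p(f₁, α₁)` exactly, then
every BCS datum `(g, k)` at `W` has `k = 0` — the balance `k + k₁ = 0` applied with `k₁ = 0`. -/
theorem defect_eq_zero_of_step (hBal : TwistDefectBalanceX9)
    (W : WeierstrassCurve ℚ) [W.IsElliptic] [W.IsGloballyMinimal] (p : ℕ) [Fact p.Prime] {dK dF : ℤ}
    (hX9 : ClassX9 W p) (hadm : BCSAdmissiblePair W p dK dF)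
    (W₁ : WeierstrassCurve ℚ) [W₁.IsElliptic] [W₁.IsGloballyMinimal]
    (hC : ∃ C : WeierstrassCurve.VariableChange ℚ, C • W₁ = W.quadraticTwist (dK : ℚ))
    (κ : ZpExtension ℚ p) (γ : Field.absoluteGaloisGroup ℚ) {N : ℕ} [NeZero N]
    (f : CuspForm (CongruenceSubgroup.Gamma0 N) 2) {N₁ : ℕ} [NeZero N₁]
    (f₁ : CuspForm (CongruenceSubgroup.Gamma0 N₁) 2)
    (hκ : κ.IsCyclotomic) (hγ : κ.IsTopGenerator γ) (hγ' : IsCyclotomicVariable p γ)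
    (hf : IsNewformOf W f) (hf₁ : IsNewformOf W₁ f₁)
    (D : W.SelmerDualData κ γ) (D₁ : W₁.SelmerDualData κ γ) (g g₁ : IwasawaAlgebra p) (k : ℤ)
    (hchar : D.charIdeal = Ideal.span {g})
    (hιg : iwasawaToPowerSeries p g =
      PowerSeries.C ((p : ℚ_[p]) ^ k) * padicLFunction f (unitRoot W p : ℚ_[p]))
    (hchar₁ : D₁.charIdeal = Ideal.span {g₁})
    (hιg₁ : iwasawaToPowerSeries p g₁ = padicLFunction f₁ (unitRoot W₁ p : ℚ_[p])) :
    k = 0 := by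
  have h := hBal W p dK dF hX9 hadm W₁ hC κ γ f f₁ hκ hγ hγ' hf hf₁ D D₁ g g₁ k 0 hchar hιg hchar₁
    (by simpa using hιg₁)
  omega

/-! ### §2 The Assembly: transport to a trivial twin (`p ∤ Tam`), residual imported (`p ∣ Tam`) -/

/-- **The route's `Assembly` item, proved.** -/
theorem twinTransportX9_assembly : Assembly := by
  intro hBal hTwin hZero hTam hPub W _ _ p _ κ γ N _ f hX9 hκ hγ hγ' hf D
  -- (buildfix 2026-08-28) route rev 3/4 re-typed `TwinDefectZeroX9` with a leading `PublishedInputsX9`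
  -- antecedent; keep `hPub` (destructure a copy) and feed it to `hZero`.
  obtain ⟨hBCSa, -, -, -, -, hmodP, -, -⟩ := id hPub
  by_cases hTamDiv : p ∣ W.tamagawaProduct
  · exact hTam W p κ γ f hX9 hTamDiv hκ hγ hγ' hf D
  -- the BCS datum `(g, k)` at `W`; it suffices to show `k = 0`
  obtain ⟨hX, g, k, hchar, hιg⟩ :=
    hBCSa W p κ γ f hX9.2.1 hX9.2.2.1 hX9.2.2.2.1 hX9.2.2.2.2.1 hκ hγ hγ' hf D
  suffices hk : k = 0 by
    subst hk
    exact ⟨hX, g, hchar, by simpa using hιg⟩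
  have hmod : exists_isNewformOf := exists_isNewformOf_of_nonempty_modularParametrizationData hmodP
  -- the twin chain
  obtain ⟨dK, dF, hadm, W₁, i₁, i₁', ⟨C, hC⟩, hcase⟩ := hTwin W p hX9 hTamDiv
  haveI := i₁; haveI := i₁'
  have hX9₁ : ClassX9 W₁ p :=
    Summit.BirchSwinnertonDyer.Rank1Residual.X9.classX9_of_smul_eq_quadraticTwist W W₁ p hX9
      hadm.1.2.1 hC hadm.2.2.1.1
  haveI : NeZero (W₁.conductorNorm ℤ) := ⟨(W₁.conductorNorm_pos_holds).ne'⟩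
  obtain ⟨f₁, hf₁⟩ := hmod W₁
  obtain ⟨D₁⟩ := W₁.nonempty_selmerDualData_holds κ γ hγ
  rcases hcase with htwin | ⟨dK', dF', hadm', W₂, i₂, i₂', ⟨C₂, hC₂⟩, htwin₂⟩
  · -- one step: exact generator at the twin `W₁`
    obtain ⟨-, g₁, hchar₁, hιg₁⟩ :=
      hZero hPub W₁ p hX9₁.2.1 hX9₁.2.2.1 hX9₁.2.2.2.1 hX9₁.2.2.2.2.1 htwin κ γ f₁ hκ hγ hγ' hf₁ D₁
    exact defect_eq_zero_of_step hBal W p hX9 hadm W₁ ⟨C, hC⟩ κ γ f f₁ hκ hγ hγ' hf hf₁ D D₁ g g₁ k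
      hchar hιg hchar₁ hιg₁
  · -- two steps: exact generator at `W₂`, BCS datum `(g₁, k₁)` at `W₁`
    haveI := i₂; haveI := i₂'
    have hX9₂ : ClassX9 W₂ p :=
      Summit.BirchSwinnertonDyer.Rank1Residual.X9.classX9_of_smul_eq_quadraticTwist W₁ W₂ p hX9₁
        hadm'.1.2.1 hC₂ hadm'.2.2.1.1
    haveI : NeZero (W₂.conductorNorm ℤ) := ⟨(W₂.conductorNorm_pos_holds).ne'⟩
    obtain ⟨f₂, hf₂⟩ := hmod W₂
    obtain ⟨D₂⟩ := W₂.nonempty_selmerDualData_holds κ γ hγ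
    obtain ⟨-, g₁, k₁, hchar₁, hιg₁⟩ :=
      hBCSa W₁ p κ γ f₁ hX9₁.2.1 hX9₁.2.2.1 hX9₁.2.2.2.1 hX9₁.2.2.2.2.1 hκ hγ hγ' hf₁ D₁
    obtain ⟨-, g₂, hchar₂, hιg₂⟩ :=
      hZero hPub W₂ p hX9₂.2.1 hX9₂.2.2.1 hX9₂.2.2.2.1 hX9₂.2.2.2.2.1 htwin₂ κ γ f₂ hκ hγ hγ' hf₂ D₂
    have hk₁ : k₁ = 0 :=
      defect_eq_zero_of_step hBal W₁ p hX9₁ hadm' W₂ ⟨C₂, hC₂⟩ κ γ f₁ f₂ hκ hγ hγ' hf₁ hf₂ D₁ D₂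
        g₁ g₂ k₁ hchar₁ hιg₁ hchar₂ hιg₂
    subst hk₁
    exact defect_eq_zero_of_step hBal W p hX9 hadm W₁ ⟨C, hC⟩ κ γ f f₁ hκ hγ hγ' hf hf₁ D D₁ g g₁ k
      hchar hιg hchar₁ (by simpa using hιg₁)

/-- The route item, by its fully qualified name. -/
theorem assembly_holds : Summit.BirchSwinnertonDyer.BirchSwinnertonDyer.Theses.TwinTransportX9.Assembly :=
  twinTransportX9_assembly

/-! ### §3 LINE 4 glue: transport to a Tamagawa twin on the `p ∣ Tam` sub-family -/

/-- **The route's `ResidualTransportX9` item, proved** — the declared residual `TamagawaResidualIMCX9`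
becomes a derived node: balance + Tamagawa-twin supply + rank-0 `BSD_p ⇒ IMC` + published inputs. -/
theorem twinTransportX9_residualTransport : ResidualTransportX9 := by
  intro hBal hTamTwin hR0 hPub W _ _ p _ κ γ N _ f hX9 hTamDiv hκ hγ hγ' hf D
  obtain ⟨hBCSa, hGr, hPer, -, -, hmodP, hmodL, hGZK⟩ := hPub
  have hZero := hR0 hBCSa hGr hPer hmodP hmodL hGZK
  obtain ⟨hX, g, k, hchar, hιg⟩ :=
    hBCSa W p κ γ f hX9.2.1 hX9.2.2.1 hX9.2.2.2.1 hX9.2.2.2.2.1 hκ hγ hγ' hf D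
  suffices hk : k = 0 by
    subst hk
    exact ⟨hX, g, hchar, by simpa using hιg⟩
  have hmod : exists_isNewformOf := exists_isNewformOf_of_nonempty_modularParametrizationData hmodP
  obtain ⟨dK, dF, hadm, W₁, i₁, i₁', ⟨C, hC⟩, hcase⟩ := hTamTwin W p hX9 hTamDiv
  haveI := i₁; haveI := i₁'
  have hX9₁ : ClassX9 W₁ p :=
    Summit.BirchSwinnertonDyer.Rank1Residual.X9.classX9_of_smul_eq_quadraticTwist W W₁ p hX9
      hadm.1.2.1 hC hadm.2.2.1.1
  haveI : NeZero (W₁.conductorNorm ℤ) := ⟨(W₁.conductorNorm_pos_holds).ne'⟩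
  obtain ⟨f₁, hf₁⟩ := hmod W₁
  obtain ⟨D₁⟩ := W₁.nonempty_selmerDualData_holds κ γ hγ
  rcases hcase with htwin | ⟨dK', dF', hadm', W₂, i₂, i₂', ⟨C₂, hC₂⟩, htwin₂⟩
  · obtain ⟨-, g₁, hchar₁, hιg₁⟩ := hZero W₁ p hX9₁ htwin κ γ f₁ hκ hγ hγ' hf₁ D₁
    exact defect_eq_zero_of_step hBal W p hX9 hadm W₁ ⟨C, hC⟩ κ γ f f₁ hκ hγ hγ' hf hf₁ D D₁ g g₁ k
      hchar hιg hchar₁ hιg₁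
  · haveI := i₂; haveI := i₂'
    have hX9₂ : ClassX9 W₂ p :=
      Summit.BirchSwinnertonDyer.Rank1Residual.X9.classX9_of_smul_eq_quadraticTwist W₁ W₂ p hX9₁
        hadm'.1.2.1 hC₂ hadm'.2.2.1.1
    haveI : NeZero (W₂.conductorNorm ℤ) := ⟨(W₂.conductorNorm_pos_holds).ne'⟩
    obtain ⟨f₂, hf₂⟩ := hmod W₂
    obtain ⟨D₂⟩ := W₂.nonempty_selmerDualData_holds κ γ hγ
    obtain ⟨-, g₁, k₁, hchar₁, hιg₁⟩ :=
      hBCSa W₁ p κ γ f₁ hX9₁.2.1 hX9₁.2.2.1 hX9₁.2.2.2.1 hX9₁.2.2.2.2.1 hκ hγ hγ' hf₁ D₁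
    obtain ⟨-, g₂, hchar₂, hιg₂⟩ := hZero W₂ p hX9₂ htwin₂ κ γ f₂ hκ hγ hγ' hf₂ D₂
    have hk₁ : k₁ = 0 :=
      defect_eq_zero_of_step hBal W₁ p hX9₁ hadm' W₂ ⟨C₂, hC₂⟩ κ γ f₁ f₂ hκ hγ hγ' hf₁ hf₂ D₁ D₂
        g₁ g₂ k₁ hchar₁ hιg₁ hchar₂ hιg₂
    subst hk₁
    exact defect_eq_zero_of_step hBal W p hX9 hadm W₁ ⟨C, hC⟩ κ γ f f₁ hκ hγ hγ' hf hf₁ D D₁ g g₁ k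
      hchar hιg hchar₁ (by simpa using hιg₁)

/-- The route item, by its fully qualified name. -/
theorem residualTransportX9_holds :
    Summit.BirchSwinnertonDyer.BirchSwinnertonDyer.Theses.TwinTransportX9.ResidualTransportX9 :=
  twinTransportX9_residualTransport

end TwinTransport

end Summit.BirchSwinnertonDyer.BirchSwinnertonDyer.Rank1Residual

end
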